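import Mathlib
import HarnessLib
import Literature.Geometry.DiscreteGeometry.BondGraph
import Literature.Geometry.DiscreteGeometry.KissingPatterns
import Literature.Algebra.EuclideanLattices.FccBccLattices

/-!
# Bond windows at the scale of a site, and the antipodal lens (crux `SoftLayerPropagation`, line `Sketch`)

Route `PricedLinkCensus`, crux `SoftLayerPropagation` (stmt-AtomisticToContinuum-14233), line
`Sketch`, helper file for the stub `develop_HX_fcc` (local no-merge): registered sub-goal
`hx_antipodal`, plus the elementary conversions from the scale-free bond graph to metric windows at
ONE length scale `ℓ = nn_x/(1+η)` around a site `x`: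

* `hx_star_scale`: a bond-neighbour `v` of `x` has `ℓ ≤ nn_v ≤ (1+η)² ℓ`; `hx_shell_scale`: a
  neighbour of such a `v` has `ℓ ≤ (1+η) nn`;
* `hx_edge`: a bond `j ~ l` with `ℓ ≤ nn_j ≤ (1+η)² ℓ` has `ℓ ≤ dist ≤ (1+η)³ ℓ` (hard core at `j`,
  bond inequality, and `min ≤ nn_j`);
* `hx_nonbond`: distinct non-bonded sites with `(1+η) nn ≥ ℓ` at both ends are `≥ ℓ` apart;
  `hx_distinct`: distinct sites are `≥ nn` apart (`nearestDist_le_dist`), `hx_soft_floor`: the same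
  with the softer scale bound `(1+η) nn ≥ ℓ`, `η ≤ 1/100`.
* **`hx_antipodal`** (vectors): two points within `ν/4` of `c ± ν e` (`‖e‖ = 1`) have no common
  point within `(26/25) ν` of both that is `≥ ν` from `c` — the ANTIPODAL case of the local no-merge
  statement (parallelogram identity: such a point is within `0.971 ν` of `c`).

All `[folklore]`.
-/

noncomputable section

namespace Summit.AtomisticToContinuum.Crystallization.Theorems

open Literature.Geometry.DiscreteGeometry

/-! ### The antipodal lens -/

/-- Parallelogram bookkeeping: `‖2t − u − k‖² = 2‖t−u‖² + 2‖t−k‖² − ‖u−k‖²` and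
`2(t − c) = (2t − u − k) + (u + k − 2c)`, in the form used below. [folklore] -/
theorem antipodal_identities (c u k t : EuclideanSpace ℝ (Fin 3)) :
    ‖t - u + (t - k)‖ ^ 2 = 2 * ‖t - u‖ ^ 2 + 2 * ‖t - k‖ ^ 2 - ‖u - k‖ ^ 2 ∧
    (2 : ℝ) • (t - c) = t - u + (t - k) + (u - c + (k - c)) := by
  constructor
  · simp only [Literature.Algebra.EuclideanLattices.norm_sq_fin_three, PiLp.add_apply, PiLp.sub_apply]
    ring
  · rw [two_smul]; abel

/-- **Registered sub-goal `hx_antipodal`: the antipodal lens is empty.**  If `‖e‖ = 1`, `ν > 0`,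
`u` is within `ν/4` of `c + ν e`, `k` within `ν/4` of `c − ν e`, and `t` is within `(26/25) ν` of both
`u` and `k`, then `dist c t < ν`. [folklore] -/
theorem hx_antipodal : ∀ (ν : ℝ) (c e u k t : EuclideanSpace ℝ (Fin 3)), 0 < ν → ‖e‖ = 1 →
    dist u (c + ν • e) ≤ ν / 4 → dist k (c - ν • e) ≤ ν / 4 →
    dist t u ≤ 26 / 25 * ν → dist t k ≤ 26 / 25 * ν → dist c t < ν := by
  intro ν c e u k t hν he hu hk htu htk
  obtain ⟨e1, e2⟩ := antipodal_identities c u k t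
  -- `‖u − k‖ ≥ 2ν − ν/2`
  have huk : 3 / 2 * ν ≤ ‖u - k‖ := by
    have h1 : u - k = (u - (c + ν • e)) - (k - (c - ν • e)) + (2 * ν) • e := by
      rw [mul_smul, two_smul]; abel
    have h2 : ‖(2 * ν) • e‖ = 2 * ν := by
      rw [norm_smul, he, mul_one, Real.norm_eq_abs, abs_of_pos (by linarith)]
    have h3 : ‖(u - (c + ν • e)) - (k - (c - ν • e))‖ ≤ ν / 4 + ν / 4 := by
      refine (norm_sub_le _ _).trans (add_le_add ?_ ?_)
      · rwa [← dist_eq_norm]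
      · rwa [← dist_eq_norm]
    have h4 : (2 * ν) • e = (u - k) - ((u - (c + ν • e)) - (k - (c - ν • e))) := by
      rw [h1]; abel
    have h5 : ‖(2 * ν) • e‖ ≤ ‖u - k‖ + ‖(u - (c + ν • e)) - (k - (c - ν • e))‖ := by
      rw [h4]; exact norm_sub_le _ _
    linarith
  -- `‖u + k − 2c‖ ≤ ν/2`
  have hmid : ‖u - c + (k - c)‖ ≤ ν / 2 := by
    have h1 : u - c + (k - c) = (u - (c + ν • e)) + (k - (c - ν • e)) := by abel
    rw [h1]
    refine (norm_add_le _ _).trans ?_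
    rw [← dist_eq_norm, ← dist_eq_norm]
    linarith
  -- the parallelogram identity
  have hW : ‖t - u + (t - k)‖ ^ 2 ≤ 2 * (26 / 25 * ν) ^ 2 + 2 * (26 / 25 * ν) ^ 2 - (3 / 2 * ν) ^ 2 := by
    rw [e1, ← dist_eq_norm, ← dist_eq_norm]
    have a1 := pow_le_pow_left₀ dist_nonneg htu 2
    have a2 := pow_le_pow_left₀ dist_nonneg htk 2
    have a3 := pow_le_pow_left₀ (by positivity) huk 2
    linarith
  have hW' : ‖t - u + (t - k)‖ ≤ 29 / 20 * ν := by
    have : ‖t - u + (t - k)‖ ^ 2 ≤ (29 / 20 * ν) ^ 2 := hW.trans (by nlinarith)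
    exact (pow_le_pow_iff_left₀ (norm_nonneg _) (by positivity) two_ne_zero).1 this
  have h2 : ‖(2 : ℝ) • (t - c)‖ ≤ 29 / 20 * ν + ν / 2 := by
    rw [e2]; exact (norm_add_le _ _).trans (add_le_add hW' hmid)
  rw [norm_smul, Real.norm_eq_abs, abs_of_pos two_pos, ← dist_eq_norm, dist_comm] at h2
  linarith

/-! ### Windows at one scale -/

variable {η : ℝ} {N : ℕ} {y : Fin N → EuclideanSpace ℝ (Fin 3)}

/-- A bond-neighbour `v` of `x` has scale in `[ℓ, (1+η)² ℓ]` for `ℓ = nn_x/(1+η)`. [folklore] -/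
theorem hx_star_scale (hη : 0 ≤ η) {x v : Fin N} (h : (bondGraph η y).Adj x v) :
    nearestDist y x / (1 + η) ≤ nearestDist y v ∧
      nearestDist y v ≤ (1 + η) ^ 2 * (nearestDist y x / (1 + η)) := by
  have hρ : (0 : ℝ) < 1 + η := by linarith
  have h1 := nearestDist_le_mul_of_adj (by linarith) h
  have h2 := nearestDist_le_mul_of_adj (by linarith) h.symm
  constructor
  · rw [div_le_iff₀ hρ]; linarith
  · have : (1 + η) ^ 2 * (nearestDist y x / (1 + η)) = (1 + η) * nearestDist y x := by
      field_simp
    rw [this]; exact h2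

/-- The scale of `x` itself lies in `[ℓ, (1+η)² ℓ]`. [folklore] -/
theorem hx_self_scale (hη : 0 ≤ η) (x : Fin N) :
    nearestDist y x / (1 + η) ≤ nearestDist y x ∧
      nearestDist y x ≤ (1 + η) ^ 2 * (nearestDist y x / (1 + η)) := by
  have hρ : (0 : ℝ) < 1 + η := by linarith
  have h0 := nearestDist_nonneg y x
  constructor
  · rw [div_le_iff₀ hρ]; nlinarith
  · have : (1 + η) ^ 2 * (nearestDist y x / (1 + η)) = (1 + η) * nearestDist y x := by
      field_simp
    rw [this]; nlinarith

/-- A neighbour `z` of a site `v` with `ℓ ≤ nn_v` has `ℓ ≤ (1+η) nn_z`. [folklore] -/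
theorem hx_shell_scale (hη : 0 ≤ η) {v z : Fin N} {ℓ : ℝ} (h : (bondGraph η y).Adj v z)
    (hv : ℓ ≤ nearestDist y v) : ℓ ≤ (1 + η) * nearestDist y z :=
  hv.trans (nearestDist_le_mul_of_adj (by linarith) h)

/-- **Edge window.**  A bond `j ~ l` with `ℓ ≤ nn_j ≤ (1+η)² ℓ` has length in `[ℓ, (1+η)³ ℓ]`, in both
orientations. [folklore] -/
theorem hx_edge (hη : 0 ≤ η) {j l : Fin N} {ℓ : ℝ} (h : (bondGraph η y).Adj j l)
    (h1 : ℓ ≤ nearestDist y j) (h2 : nearestDist y j ≤ (1 + η) ^ 2 * ℓ) :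
    (ℓ ≤ dist (y j) (y l) ∧ dist (y j) (y l) ≤ (1 + η) ^ 3 * ℓ) ∧
      (ℓ ≤ dist (y l) (y j) ∧ dist (y l) (y j) ≤ (1 + η) ^ 3 * ℓ) := by
  obtain ⟨hne, hle⟩ := bondGraph_adj.1 h
  have lo : ℓ ≤ dist (y j) (y l) := h1.trans (nearestDist_le_dist y hne.symm)
  have hi : dist (y j) (y l) ≤ (1 + η) ^ 3 * ℓ :=
    calc dist (y j) (y l) ≤ (1 + η) * min (nearestDist y j) (nearestDist y l) := hle
      _ ≤ (1 + η) * nearestDist y j := mul_le_mul_of_nonneg_left (min_le_left _ _) (by linarith)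
      _ ≤ (1 + η) * ((1 + η) ^ 2 * ℓ) := mul_le_mul_of_nonneg_left h2 (by linarith)
      _ = (1 + η) ^ 3 * ℓ := by ring
  refine ⟨⟨lo, hi⟩, ?_, ?_⟩ <;> rw [dist_comm] <;> assumption

/-- **Non-bond floor.**  Distinct non-bonded sites with `(1+η) nn ≥ ℓ` at both ends are `≥ ℓ` apart.
[folklore] -/
theorem hx_nonbond (hη : 0 ≤ η) {j l : Fin N} {ℓ : ℝ} (hne : j ≠ l) (h : ¬ (bondGraph η y).Adj j l)
    (h1 : ℓ ≤ (1 + η) * nearestDist y j) (h2 : ℓ ≤ (1 + η) * nearestDist y l) :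
    ℓ ≤ dist (y j) (y l) ∧ ℓ ≤ dist (y l) (y j) := by
  rw [bondGraph_adj, not_and] at h
  have h' := h hne
  push Not at h'
  have : ℓ ≤ (1 + η) * min (nearestDist y j) (nearestDist y l) := by
    rw [mul_min_of_nonneg _ _ (by linarith : (0 : ℝ) ≤ 1 + η)]
    exact le_min h1 h2
  refine ⟨this.trans h'.le, ?_⟩
  rw [dist_comm]; exact this.trans h'.le

/-- **Hard core.**  Distinct sites are `≥ nn_j` apart, so `≥ ℓ` if `ℓ ≤ nn_j`. [folklore] -/
theorem hx_distinct {j l : Fin N} {ℓ : ℝ} (hne : j ≠ l) (h1 : ℓ ≤ nearestDist y j) :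
    ℓ ≤ dist (y j) (y l) ∧ ℓ ≤ dist (y l) (y j) := by
  have := h1.trans (nearestDist_le_dist y hne.symm)
  exact ⟨this, by rwa [dist_comm]⟩

/-- **Soft hard core.**  Distinct sites with `ℓ ≤ (1+η) nn_j`, `0 ≤ η ≤ 1/100`, are `≥ ℓ/1.01` apart:
`ℓ ≤ (101/100) dist`. [folklore] -/
theorem hx_soft_floor (hη : 0 ≤ η) (hη' : η ≤ 1 / 100) {j l : Fin N} {ℓ : ℝ} (hne : j ≠ l)
    (h1 : ℓ ≤ (1 + η) * nearestDist y j) : ℓ ≤ 101 / 100 * dist (y l) (y j) := by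
  have h := nearestDist_le_dist y (j := j) (k := l) hne.symm
  rw [dist_comm] at h
  have h0 : 0 ≤ dist (y l) (y j) := dist_nonneg
  nlinarith

end Summit.AtomisticToContinuum.Crystallization.Theorems

end
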